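import Summits.QuantumFields.YangMills.Theorems.BalabanUVNodesN22AtU3OfKernels
import Literature.MathematicalPhysics.QuantumFieldTheory.Balaban1983to89.T4CouplingMatching

/-!
# NODE N22 (NE9) AT THE KERNEL-KEYED NODE-U3 OBJECTS — THE WINDOWED INPUT OF THE (1.21) PASSAGE IN β-LAYER ∕ DERIVATIVE CURRENCY:
# coordinatewise history moduli on the box ⇒ joint history-Lipschitz bounds (weighted telescoping); coordinatewise DERIVATIVE bounds ⇒ moduli
# (mean value theorem); `T4CouplingMatching.HistLipschitz` of the windowed-kernel family ⇒ the windowed bounds of `…N22AtU3OfKernels`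

Cell `pub-ymgap`, Track A (HUMAN RULING D-0062), WIDTH SEAT `dag-n22-w3` g2 on node n22 = NE9; `--kind proof --supports stmt-QuantumFields-20544 --as helper`,
COUNT-NEUTRAL.  Sequel of `Thm/BalabanUVNodesN22AtU3OfKernels.lean` (this seat): there, `N22At` at def-W1's kernel objects `Node00.U3OfKernels.objects ∕
objectsOfRecord₁₃` (W1-19) follows from def-B's `PolLimitExists` + JOINT history-Lipschitz bounds on the WINDOWED finite-volume kernels
`polWindow F K (k+1) (ℰ k (g_0,…,g_k) K) ρ bV μ ν z`.  Print's nearest statement about the coupling dependence is PER COORDINATE and DIFFERENTIAL: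
[I] p. 263 «It is a C^∞-function of g_{j−1} ∈ [0, γ], (or analytic)», p. 264 «uniformly bounded on this interval together with all derivatives»,
p. 298 «β_j … depends also on all preceding coupling constants».  This file types the two estimate-free calculus steps from that shape to the joint bound:

* §1 **WEIGHTED TELESCOPING ON THE BOX** `FlowStep.Box γ k = ]0, γ]^{k+1}`: if changing ONE coordinate `i` of a box point within `]0, γ]` moves
  `f : (Fin (k+1) → ℝ) → ℝ` by at most `Λ i · |Δ|` (coordinatewise MODULI — the weighted twin of `BetaDerivClause.CoordLipschitzAt`'s single constant), then
  `|f q − f p| ≤ Σ_i Λ i |q_i − p_i|` on the box (`abs_sub_le_sum_of_coordModuli`; induction over `Finset.piecewise`, every intermediate point stays in the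
  product box).  §1b the MEAN VALUE step: coordinatewise derivative bounds `|∂_i f| ≤ Λ i` within `[0, γ]` along each coordinate line through box points
  give the coordinatewise moduli (`coordModuli_of_coordDeriv`, `Convex.norm_image_sub_le_of_norm_hasDerivWithin_le`).
* §2 **β-LAYER CURRENCY**: for each volume index `K`, directions `μ ν` and separation `z` the windowed kernels form an `FlowStep.HBeta`-shaped family
  `fun k v => polWindow F K (k+1) (ℰ k v K) ρ bV μ ν z`; node U2's `T4CouplingMatching.HistLipschitz (fun k i => e^{−κ|z|₁} Λ (k+1) i) γ` of it, for
  every `(K, μ, ν, z)`, IS the windowed hypothesis `hK` of `ne9_EA_of_windowed_forall` (`windowedBounds_of_histLipschitz`: `histPrefix g k ∈ Box γ k` for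
  `g ∈ Window γ`, `Fin.sum_univ_eq_sum_range`) — so NE9 of the kernel functional and `N22At` at the kernel objects follow from `PolLimitExists` + that
  family of `HistLipschitz` clauses (`ne9_EA_of_histLipschitz`, `n22At_u3OfRecord₁₃_objects_of_histLipschitz`), from coordinatewise moduli
  (`…_of_coordModuli`) and from coordinatewise derivative bounds (`…_of_coordDeriv`) — the print-nearest displayed shape.
* §3 **θ-KEYED FAMILY FORMS** at NODE 00's v1.7 Stage-13 record (any guard `G`, letter blocks `ℓ F θ` read at the tuple — the twin of dag-n27-w1's
  `forall_readOutAt_objectsOfRecord₁₃_coPH` for (D4)): `forall_n22At_objectsOfRecord₁₃_coPH` and, for a residual rate reading PINNED to the kernel objects of record at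
  every tuple, `forall_n22At_rateCarriers_of_kernels_pin` — the N22 component of K3⁷ v2's `KeyedRatesHolderD4` in hypothesis form (per-tuple signs + per-tuple `NE9` of
  the kernel functional of record ⇒ `N22At (rateCarriersOfRecord₁₃CoPH 𝔯 F θ hP g₀ os k).u3` at every guarded admissible tuple, every `g₀ os k`).

HONEST FRAMING (binding).  Calculus bookkeeping; THEOREMS ONLY (0 def, 0 sorry, standard axioms).  The coordinatewise moduli ∕ derivative bounds of
the windowed kernels with weights `e^{−κ|z|₁} C₉ ω^{k+1−i}` (= NE9 at finite volume with fading memory) are a cell NEW ESTIMATE, NOT PRINTED for d = 4,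
and STAY DISPLAYED HYPOTHESES, as does the existence of the (1.21) limits; nothing of Bałaban's is asserted; N22 NOT discharged; K3⁷ OPEN, not
claimed; no count claim; one finite 𝕋⁴ programme at fixed ε — R4 closes the conditional rung `BalabanLadder.UV` only; NOTHING about the continuum
limit, ℝ⁴, OS axioms, a mass gap or the Clay problem is proved or claimed.  No decl below carries a cite tag (Summit side).
-/

noncomputable section

open Filter Topology
open scoped BigOperators

namespace YMDAG.N22.AtKernels

open Literature.MathematicalPhysics.QuantumFieldTheory.Balaban1983to89
open Literature.MathematicalPhysics.QuantumFieldTheory.Balaban1983to89.T4Continuum (T4Family)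
open Literature.MathematicalPhysics.QuantumFieldTheory.Balaban1983to89.T4OutputRate (Window NE9)
open Literature.MathematicalPhysics.QuantumFieldTheory.Balaban1983to89.FlowStep (Box mem_box HBeta)
open Literature.MathematicalPhysics.QuantumFieldTheory.Balaban1983to89.T4CouplingMatching (HistLipschitz)
open Literature.MathematicalPhysics.QuantumFieldTheory.Balaban1983to89.Node00 (TermFamily1 polWindow PolLimitExists Stage13Params U3Letters₁₁)
open Literature.MathematicalPhysics.QuantumFieldTheory.Balaban1983to89.Node00.U3OfKernels (histPrefix kernelA EA objects)
open Literature.MathematicalPhysics.QuantumFieldTheory.Balaban1983to89.B12Sec2to5 (l1)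
open YMDAG.UVSplit (N22At u3OfRecord₁₃)

/-! ## §1 Weighted telescoping on the box and the mean value step -/

section Box

variable {k : ℕ} {γ : ℝ}

/-- A `Finset.piecewise` mixture of two box points is a box point (the box is a product). -/
theorem piecewise_mem_flowBox (s : Finset (Fin (k + 1))) {p q : Fin (k + 1) → ℝ} (hp : p ∈ Box γ k) (hq : q ∈ Box γ k) :
    s.piecewise q p ∈ Box γ k :=
  s.piecewise_mem_set_pi hq hp

/-- **WEIGHTED TELESCOPING**: coordinatewise moduli `Λ i` on the box `]0, γ]^{k+1}` (changing the `i`-th coordinate of a box point within `]0, γ]` moves `f` by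
at most `Λ i · |Δ|`) give the joint bound `|f q − f p| ≤ Σ_i Λ i · |q_i − p_i|` for box points `p, q`.  (Weighted twin of
`BetaDerivClause.abs_sub_le_sum_of_coordLipschitz`; induction over the coordinates switched from `p` to `q`.) -/
theorem abs_sub_le_sum_of_coordModuli (f : (Fin (k + 1) → ℝ) → ℝ) (Λ : Fin (k + 1) → ℝ)
    (h : ∀ p ∈ Box γ k, ∀ (i : Fin (k + 1)) (t : ℝ), 0 < t → t ≤ γ → |f (Function.update p i t) - f p| ≤ Λ i * |t - p i|)
    {p q : Fin (k + 1) → ℝ} (hp : p ∈ Box γ k) (hq : q ∈ Box γ k) :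
    |f q - f p| ≤ ∑ i, Λ i * |q i - p i| := by
  classical
  suffices H : ∀ s : Finset (Fin (k + 1)), |f (s.piecewise q p) - f p| ≤ ∑ i ∈ s, Λ i * |q i - p i| by
    simpa only [Finset.piecewise_univ] using H Finset.univ
  intro s
  induction s using Finset.induction_on with
  | empty => simp
  | @insert j s hj ih =>
    rw [Finset.piecewise_insert, Finset.sum_insert hj]
    have hqj : 0 < q j ∧ q j ≤ γ := (mem_box.mp hq) j
    have step := h (s.piecewise q p) (piecewise_mem_flowBox s hp hq) j (q j) hqj.1 hqj.2
    rw [Finset.piecewise_eq_of_notMem _ _ _ hj] at step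
    calc |f (Function.update (s.piecewise q p) j (q j)) - f p|
        ≤ |f (Function.update (s.piecewise q p) j (q j)) - f (s.piecewise q p)| + |f (s.piecewise q p) - f p| := abs_sub_le _ _ _
      _ ≤ Λ j * |q j - p j| + ∑ i ∈ s, Λ i * |q i - p i| := add_le_add step ih

/-- **THE MEAN VALUE STEP**: coordinatewise DERIVATIVE bounds — along the `i`-th coordinate line through every box point, `t ↦ f (update p i t)` is differentiable
within `[0, γ]` with derivative bounded by `Λ i` there — give the coordinatewise moduli `Λ i`.  (`Convex.norm_image_sub_le_of_norm_hasDerivWithin_le` on `[0, γ]`;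
the weighted twin of `BetaDerivClause.lastVarLipschitz_of_derivBound`, every coordinate.) -/
theorem coordModuli_of_coordDeriv (f : (Fin (k + 1) → ℝ) → ℝ) (Λ : Fin (k + 1) → ℝ)
    (h : ∀ p ∈ Box γ k, ∀ i : Fin (k + 1), ∃ f' : ℝ → ℝ,
      (∀ t ∈ Set.Icc (0 : ℝ) γ, HasDerivWithinAt (fun t : ℝ => f (Function.update p i t)) (f' t) (Set.Icc (0 : ℝ) γ) t) ∧
      ∀ t ∈ Set.Icc (0 : ℝ) γ, |f' t| ≤ Λ i) :
    ∀ p ∈ Box γ k, ∀ (i : Fin (k + 1)) (t : ℝ), 0 < t → t ≤ γ → |f (Function.update p i t) - f p| ≤ Λ i * |t - p i| := by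
  intro p hp i t ht htγ
  obtain ⟨f', hf', hb⟩ := h p hp i
  have hpi : 0 < p i ∧ p i ≤ γ := (mem_box.mp hp) i
  have key := (convex_Icc (0 : ℝ) γ).norm_image_sub_le_of_norm_hasDerivWithin_le
    (f := fun t : ℝ => f (Function.update p i t)) (f' := f') (fun x hx => hf' x hx)
    (fun x hx => by simpa [Real.norm_eq_abs] using hb x hx) ⟨hpi.1.le, hpi.2⟩ ⟨ht.le, htγ⟩
  simpa [Real.norm_eq_abs, Function.update_eq_self] using key

/-- Coordinatewise derivative bounds ⇒ the joint weighted bound on the box (§1 composed). -/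
theorem abs_sub_le_sum_of_coordDeriv (f : (Fin (k + 1) → ℝ) → ℝ) (Λ : Fin (k + 1) → ℝ)
    (h : ∀ p ∈ Box γ k, ∀ i : Fin (k + 1), ∃ f' : ℝ → ℝ,
      (∀ t ∈ Set.Icc (0 : ℝ) γ, HasDerivWithinAt (fun t : ℝ => f (Function.update p i t)) (f' t) (Set.Icc (0 : ℝ) γ) t) ∧
      ∀ t ∈ Set.Icc (0 : ℝ) γ, |f' t| ≤ Λ i)
    {p q : Fin (k + 1) → ℝ} (hp : p ∈ Box γ k) (hq : q ∈ Box γ k) :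
    |f q - f p| ≤ ∑ i, Λ i * |q i - p i| :=
  abs_sub_le_sum_of_coordModuli f Λ (coordModuli_of_coordDeriv f Λ h) hp hq

/-- The history prefix of a window sequence is a box point. -/
theorem histPrefix_mem_box {g : ℕ → ℝ} (hg : g ∈ Window γ) (k : ℕ) : histPrefix g k ∈ Box γ k :=
  mem_box.mpr fun i => hg i

end Box

/-! ## §2 β-layer currency: `HistLipschitz` of the windowed-kernel family ⇒ the windowed bounds ⇒ NE9 ∕ N22 at the kernel objects -/

section Kernels

variable {𝔄 : Type*} [NormedRing 𝔄] [NormedAlgebra ℝ 𝔄]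
variable {V : Type*} [NormedAddCommGroup V] [NormedSpace ℝ V] {ι : Type*} [Fintype ι]
variable (F : T4Family) (ℰ : TermFamily1 F 𝔄) (ρ : V →L[ℝ] 𝔄) (bV : Module.Basis ι ℝ V)

/-- **`HistLipschitz` OF THE WINDOWED-KERNEL FAMILY ⇒ THE WINDOWED BOUNDS** (the `hK` of `ne9_EA_of_windowed_forall`): for each `(K, μ, ν, z)` the `HBeta`-shaped
family `fun k v => polWindow F K (k+1) (ℰ k v K) ρ bV μ ν z` with node U2's history moduli `e^{−κ|z|₁} Λ (k+1) i` on the box `]0, γ]^{k+1}` bounds the difference of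
the windowed kernels at the prefixes of two window sequences. -/
theorem windowedBounds_of_histLipschitz {γ κ : ℝ} {Λ : ℕ → ℕ → ℝ}
    (h : ∀ (K : ℕ) (μ ν : Fin 4) (z : Fin 4 → ℤ),
      HistLipschitz (fun k i => Real.exp (-(κ * l1 z)) * Λ (k + 1) i) γ (fun k v => polWindow F K (k + 1) (ℰ k v K) ρ bV μ ν z)) :
    ∀ g ∈ Window γ, ∀ g' ∈ Window γ, ∀ (K k : ℕ) (μ ν : Fin 4) (z : Fin 4 → ℤ),
      |polWindow F K (k + 1) (ℰ k (histPrefix g k) K) ρ bV μ ν z - polWindow F K (k + 1) (ℰ k (histPrefix g' k) K) ρ bV μ ν z| ≤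
        Real.exp (-(κ * l1 z)) * ∑ i ∈ Finset.range (k + 1), Λ (k + 1) i * |g i - g' i| := by
  intro g hg g' hg' K k μ ν z
  have hh := h K μ ν z k (histPrefix g k) (histPrefix g' k) (histPrefix_mem_box hg k) (histPrefix_mem_box hg' k)
  rw [Finset.mul_sum, ← Fin.sum_univ_eq_sum_range (fun i => Real.exp (-(κ * l1 z)) * (Λ (k + 1) i * |g i - g' i|)) (k + 1)]
  simpa only [Node00.U3OfKernels.histPrefix_apply, mul_assoc] using hh

/-- **COORDINATEWISE MODULI OF THE WINDOWED KERNELS ⇒ THE WINDOWED BOUNDS**: if changing the coupling `g_i` alone within `]0, γ]` moves the windowed kernel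
`polWindow F K (k+1) (ℰ k · K) ρ bV μ ν z` by at most `e^{−κ|z|₁} Λ (k+1) i · |Δg_i|` on the box, the joint bounds follow (§1 telescoping). -/
theorem windowedBounds_of_coordModuli {γ κ : ℝ} {Λ : ℕ → ℕ → ℝ}
    (h : ∀ (K : ℕ) (μ ν : Fin 4) (z : Fin 4 → ℤ) (k : ℕ), ∀ p ∈ Box γ k, ∀ (i : Fin (k + 1)) (t : ℝ), 0 < t → t ≤ γ →
      |polWindow F K (k + 1) (ℰ k (Function.update p i t) K) ρ bV μ ν z - polWindow F K (k + 1) (ℰ k p K) ρ bV μ ν z| ≤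
        Real.exp (-(κ * l1 z)) * Λ (k + 1) i * |t - p i|) :
    ∀ g ∈ Window γ, ∀ g' ∈ Window γ, ∀ (K k : ℕ) (μ ν : Fin 4) (z : Fin 4 → ℤ),
      |polWindow F K (k + 1) (ℰ k (histPrefix g k) K) ρ bV μ ν z - polWindow F K (k + 1) (ℰ k (histPrefix g' k) K) ρ bV μ ν z| ≤
        Real.exp (-(κ * l1 z)) * ∑ i ∈ Finset.range (k + 1), Λ (k + 1) i * |g i - g' i| := by
  refine windowedBounds_of_histLipschitz F ℰ ρ bV fun K μ ν z k p q hp hq => ?_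
  have := abs_sub_le_sum_of_coordModuli (fun v => polWindow F K (k + 1) (ℰ k v K) ρ bV μ ν z)
    (fun i => Real.exp (-(κ * l1 z)) * Λ (k + 1) i) (fun p hp i t ht htγ => h K μ ν z k p hp i t ht htγ) hq hp
  simpa only using this

/-- **COORDINATEWISE DERIVATIVE BOUNDS ⇒ THE WINDOWED BOUNDS** (the print-nearest displayed shape, [I] pp. 263–264, 298: per-coupling derivatives of the
finite-volume kernels bounded by `e^{−κ|z|₁} Λ (k+1) i` within `[0, γ]`): mean value step + telescoping. -/
theorem windowedBounds_of_coordDeriv {γ κ : ℝ} {Λ : ℕ → ℕ → ℝ}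
    (h : ∀ (K : ℕ) (μ ν : Fin 4) (z : Fin 4 → ℤ) (k : ℕ), ∀ p ∈ Box γ k, ∀ i : Fin (k + 1), ∃ f' : ℝ → ℝ,
      (∀ t ∈ Set.Icc (0 : ℝ) γ,
        HasDerivWithinAt (fun t : ℝ => polWindow F K (k + 1) (ℰ k (Function.update p i t) K) ρ bV μ ν z) (f' t) (Set.Icc (0 : ℝ) γ) t) ∧
      ∀ t ∈ Set.Icc (0 : ℝ) γ, |f' t| ≤ Real.exp (-(κ * l1 z)) * Λ (k + 1) i) :
    ∀ g ∈ Window γ, ∀ g' ∈ Window γ, ∀ (K k : ℕ) (μ ν : Fin 4) (z : Fin 4 → ℤ),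
      |polWindow F K (k + 1) (ℰ k (histPrefix g k) K) ρ bV μ ν z - polWindow F K (k + 1) (ℰ k (histPrefix g' k) K) ρ bV μ ν z| ≤
        Real.exp (-(κ * l1 z)) * ∑ i ∈ Finset.range (k + 1), Λ (k + 1) i * |g i - g' i| :=
  windowedBounds_of_coordModuli F ℰ ρ bV fun K μ ν z k =>
    coordModuli_of_coordDeriv (fun v => polWindow F K (k + 1) (ℰ k v K) ρ bV μ ν z) (fun i => Real.exp (-(κ * l1 z)) * Λ (k + 1) i) (h K μ ν z k)

/-- ★ **NE9 OF THE KERNEL FUNCTIONAL FROM `PolLimitExists` AND THE `HistLipschitz` CLAUSES OF THE WINDOWED-KERNEL FAMILIES** (β-layer currency in, node-U3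
currency out). -/
theorem ne9_EA_of_histLipschitz {γ κ : ℝ} {Λ : ℕ → ℕ → ℝ}
    (hlim : ∀ g ∈ Window γ, ∀ k : ℕ, PolLimitExists F (k + 1) (fun K => ℰ k (histPrefix g k) K) ρ bV)
    (h : ∀ (K : ℕ) (μ ν : Fin 4) (z : Fin 4 → ℤ),
      HistLipschitz (fun k i => Real.exp (-(κ * l1 z)) * Λ (k + 1) i) γ (fun k v => polWindow F K (k + 1) (ℰ k v K) ρ bV μ ν z)) :
    NE9 (EA F ℰ ρ bV) (Window γ) κ Λ :=
  ne9_EA_of_windowed_forall F ℰ ρ bV hlim (windowedBounds_of_histLipschitz F ℰ ρ bV h)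

/-- ★ NE9 of the kernel functional from `PolLimitExists` and COORDINATEWISE DERIVATIVE BOUNDS on the windowed kernels. -/
theorem ne9_EA_of_coordDeriv {γ κ : ℝ} {Λ : ℕ → ℕ → ℝ}
    (hlim : ∀ g ∈ Window γ, ∀ k : ℕ, PolLimitExists F (k + 1) (fun K => ℰ k (histPrefix g k) K) ρ bV)
    (h : ∀ (K : ℕ) (μ ν : Fin 4) (z : Fin 4 → ℤ) (k : ℕ), ∀ p ∈ Box γ k, ∀ i : Fin (k + 1), ∃ f' : ℝ → ℝ,
      (∀ t ∈ Set.Icc (0 : ℝ) γ,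
        HasDerivWithinAt (fun t : ℝ => polWindow F K (k + 1) (ℰ k (Function.update p i t) K) ρ bV μ ν z) (f' t) (Set.Icc (0 : ℝ) γ) t) ∧
      ∀ t ∈ Set.Icc (0 : ℝ) γ, |f' t| ≤ Real.exp (-(κ * l1 z)) * Λ (k + 1) i) :
    NE9 (EA F ℰ ρ bV) (Window γ) κ Λ :=
  ne9_EA_of_windowed_forall F ℰ ρ bV hlim (windowedBounds_of_coordDeriv F ℰ ρ bV h)

variable {N : ℕ} [NeZero N]

/-- ★ **N22 AT THE KERNEL OBJECTS FROM `PolLimitExists` AND THE `HistLipschitz` CLAUSES** with the fading-memory moduli `C₉ ω^{k+1−i}` of the letter block. -/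
theorem n22At_u3OfRecord₁₃_objects_of_histLipschitz (θ : Stage13Params F N) (ℓ : U3Letters₁₁) (hs : ℓ.Signs) (k : ℕ)
    (hlim : ∀ g ∈ Window θ.γ, ∀ j : ℕ, PolLimitExists F (j + 1) (fun K => ℰ j (histPrefix g j) K) ρ bV)
    (h : ∀ (K : ℕ) (μ ν : Fin 4) (z : Fin 4 → ℤ),
      HistLipschitz (fun j i => Real.exp (-(ℓ.κ * l1 z)) * ℓ.moduli (j + 1) i) θ.γ (fun j v => polWindow F K (j + 1) (ℰ j v K) ρ bV μ ν z)) :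
    N22At (u3OfRecord₁₃ θ (objects F ℰ ρ bV ℓ) k) :=
  n22At_u3OfRecord₁₃_objects_of_ne9 F ℰ ρ bV θ ℓ hs k (ne9_EA_of_histLipschitz F ℰ ρ bV hlim h)

/-- ★ **N22 AT THE KERNEL OBJECTS FROM `PolLimitExists` AND COORDINATEWISE DERIVATIVE BOUNDS** `|∂_{g_i} Π^{(K)}_{j+1,μν}(g; z)| ≤ e^{−κ|z|₁} C₉ ω^{j+1−i}` within
`[0, θ.γ]` along each coordinate line through the box (the print-nearest displayed shape; LOCATED — hypothesis form). -/
theorem n22At_u3OfRecord₁₃_objects_of_coordDeriv (θ : Stage13Params F N) (ℓ : U3Letters₁₁) (hs : ℓ.Signs) (k : ℕ)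
    (hlim : ∀ g ∈ Window θ.γ, ∀ j : ℕ, PolLimitExists F (j + 1) (fun K => ℰ j (histPrefix g j) K) ρ bV)
    (h : ∀ (K : ℕ) (μ ν : Fin 4) (z : Fin 4 → ℤ) (j : ℕ), ∀ p ∈ Box θ.γ j, ∀ i : Fin (j + 1), ∃ f' : ℝ → ℝ,
      (∀ t ∈ Set.Icc (0 : ℝ) θ.γ,
        HasDerivWithinAt (fun t : ℝ => polWindow F K (j + 1) (ℰ j (Function.update p i t) K) ρ bV μ ν z) (f' t) (Set.Icc (0 : ℝ) θ.γ) t) ∧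
      ∀ t ∈ Set.Icc (0 : ℝ) θ.γ, |f' t| ≤ Real.exp (-(ℓ.κ * l1 z)) * ℓ.moduli (j + 1) i) :
    N22At (u3OfRecord₁₃ θ (objects F ℰ ρ bV ℓ) k) :=
  n22At_u3OfRecord₁₃_objects_of_ne9 F ℰ ρ bV θ ℓ hs k (ne9_EA_of_coordDeriv F ℰ ρ bV hlim h)

end Kernels

/-! ## §3 θ-keyed family forms at NODE 00's v1.7 Stage-13 record (the `hN22`-binder SHAPE of K3⁷ v2's `KeyedRatesHolderD4`, any guard `G`) -/

section Keyed

open Literature.MathematicalPhysics.QuantumFieldTheory.Balaban1983to89.Node00 (Stage13HParams)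
open Literature.MathematicalPhysics.QuantumFieldTheory.Balaban1983to89.Node00.U3OfKernels (objectsOfRecord₁₃)
open Literature.MathematicalPhysics.QuantumFieldTheory.Balaban1983to89.T4Continuum (ULoop)
open YMDAG.UVSplit (RateReading₁₃CoPH rateCarriersOfRecord₁₃CoPH)

variable (N : ℕ) [NeZero N]

/-- **THE θ-KEYED FAMILY FORM OF THE N22 SLOT AT THE KERNEL OBJECTS OF RECORD** (twin of dag-n27-w1's `forall_readOutAt_objectsOfRecord₁₃_coPH` for (D4); any guard
`G`, letter blocks `ℓ F θ` read at the tuple): from per-tuple signs and per-tuple `NE9` of the kernel functional of record (level-free objects: `.EA 0`), `N22At` at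
the bundle of every run length at every guarded admissible tuple.  Hypothesis form; NOT a discharge. -/
theorem forall_n22At_objectsOfRecord₁₃_coPH (G : ∀ {F : T4Family}, Stage13HParams F N → Prop) (ℓ : (F : T4Family) → Stage13HParams F N → U3Letters₁₁)
    (hs : ∀ (F : T4Family) (θ : Stage13HParams F N), θ.Provisos₁₃CoPH F N → G θ → θ.Admissible F N → (ℓ F θ).Signs)
    (h9 : ∀ (F : T4Family) (θ : Stage13HParams F N), θ.Provisos₁₃CoPH F N → G θ → θ.Admissible F N →
      NE9 ((objectsOfRecord₁₃ F N θ.toStage13Params (ℓ F θ)).EA 0) (Window θ.γ) (ℓ F θ).κ (ℓ F θ).moduli) :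
    ∀ (F : T4Family) (θ : Stage13HParams F N), θ.Provisos₁₃CoPH F N → G θ → θ.Admissible F N → ∀ k : ℕ,
      N22At (u3OfRecord₁₃ θ.toStage13Params (objectsOfRecord₁₃ F N θ.toStage13Params (ℓ F θ)) k) :=
  fun F θ hP hG hθ k =>
    (n22At_u3OfRecord₁₃_objectsOfRecord₁₃_iff F N θ.toStage13Params (ℓ F θ) (hs F θ hP hG hθ) k).2 (h9 F θ hP hG hθ)

variable {N}

/-- ★★ **THE N22 COMPONENT OF K3⁷ v2's `KeyedRatesHolderD4` FOR A READING PINNED TO THE KERNEL OBJECTS OF RECORD** (any guard `G`; the skeleton's is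
`θ.ZhUnity F 2 ∧ θ.SlotsNondegenerate₁₃ F 2`): if the residual reading's node-U3 objects ARE `objectsOfRecord₁₃ … (ℓ F θ)` at every tuple (`hpin`), per-tuple signs and
per-tuple `NE9` of the kernel functional of record give `N22At (rateCarriersOfRecord₁₃CoPH 𝔯 F θ hP g₀ os k).u3` at every guarded admissible tuple, every `g₀, os, k` — in
particular at the selected run length `ksel …` of `rrOfRecord 𝔯 ksel`.  Hypothesis form; N22 NOT discharged. -/
theorem forall_n22At_rateCarriers_of_kernels_pin (𝔯 : RateReading₁₃CoPH N) (G : ∀ {F : T4Family}, Stage13HParams F N → Prop)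
    (ℓ : (F : T4Family) → Stage13HParams F N → U3Letters₁₁)
    (hpin : ∀ (F : T4Family) (θ : Stage13HParams F N) (hP : θ.Provisos₁₃CoPH F N) (g₀ : ℕ → ℝ) (os : List (ULoop F)),
      (𝔯.lit F θ hP g₀ os).u3 = objectsOfRecord₁₃ F N θ.toStage13Params (ℓ F θ))
    (hs : ∀ (F : T4Family) (θ : Stage13HParams F N), θ.Provisos₁₃CoPH F N → G θ → θ.Admissible F N → (ℓ F θ).Signs)
    (h9 : ∀ (F : T4Family) (θ : Stage13HParams F N), θ.Provisos₁₃CoPH F N → G θ → θ.Admissible F N →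
      NE9 ((objectsOfRecord₁₃ F N θ.toStage13Params (ℓ F θ)).EA 0) (Window θ.γ) (ℓ F θ).κ (ℓ F θ).moduli) :
    ∀ (F : T4Family) (θ : Stage13HParams F N) (hP : θ.Provisos₁₃CoPH F N), G θ → θ.Admissible F N →
      ∀ (g₀ : ℕ → ℝ) (os : List (ULoop F)) (k : ℕ), N22At (rateCarriersOfRecord₁₃CoPH 𝔯 F θ hP g₀ os k).u3 :=
  fun F θ hP hG hθ g₀ os k =>
    n22At_rateCarriers_of_kernels_pin_of_ne9 𝔯 θ hP g₀ os (ℓ F θ) (hs F θ hP hG hθ) (hpin F θ hP g₀ os) (h9 F θ hP hG hθ) k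

end Keyed

end YMDAG.N22.AtKernels

end
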